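import Summits.CriticalPhenomena.PercolationContinuityZ3.Theorems.Transplant.FKConnectivityAllQThreePointGraded
import Literature.Probability.LatticeModels.RandomClusterEdgeWeights
import HarnessLib

/-!
# The graded three-point node is 'the three-point inequality for EVERY random-cluster measure, coefficientwise in q':
# graded folding fibres for `φ_{w,q} ⊗ φ_{w,q}` and the arrow `ThreePointGradedOn V → ∀ q > 0`, three-point for `rcMeasureW w q ∅`

Support file (`--supports stmt-CriticalPhenomena-4575`), FK sub-lane `prim-bschramm-fk-1` (generation 34) of the post-continuity
programme; builds on p205010 (kernel theorem, internal audit signed; external expert review pending).  Theorems only; no named facts,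
no sorries; standard axioms.

GRADED FOLDING (new, the `q`-analogue of `Literature/…/FoldingFibres.lean`).  For the edge-parameter random-cluster weights
`W_q(ω) = w(ω) q^{k(ω)}` (`rcWeightW w q ∅`) the pair weight `W_q(a) W_q(b)` is NOT constant on the folding fibre `{(a, a ∆ M) : a ∖ M = u}`
of the disagreement set `M` and common part `u`, but `w(a) w(a ∆ M) = w(u) w(u ∆ M)` is, and the remaining factor is `q^{k(a) + k(a ∆ M)}` —
constant on each LEVEL of the fibre.  Hence (**`sum_rcWeightW_ind_mul_sum_eq_sum_fibres`**)
`(Σ_a W_q(a) 1_A(a)) (Σ_b W_q(b) 1_B(b)) = Σ_M Σ_u w(u) w(u ∆ M) Σ_L q^L · N_L(A;B)` with `N_L(A;B) = fibreCountL M u A B L` the graded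
fibre count of `…ThreePointGraded`, and (**`rcMeasureW_real_mul_eq_sum_fibres_graded`**) the same for `φ(A) φ(B) · Z²`, `φ = rcMeasureW w q ∅`.
So an inequality between (sums of) graded fibre counts, level by level, is an inequality between (sums of) products `φ(A)φ(B)` for EVERY
`q > 0` and every `w` (**`rcMeasureW_three_mul_le_of_graded_fibrewise`**): 'coefficientwise in the fibre and in `q`'.
CONSEQUENCE (**`threePoint_rcMeasureW_of_graded`**): the graded three-point node `ThreePointGradedOn V` (g34, NOT asserted) gives, for every
`q > 0` and every `w`, the three-point inequality `φ(OV)φ(OY) + φ(OV)φ(VY) + φ(OY)φ(VY) ≤ φ(0)φ(OVY)` for two independent samples of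
`φ_{w,q}` — including `q < 1`, where `φ_{w,q}` is not positively associated (Grimmett 2006 Thm (3.8) needs `q ≥ 1`); its `q = 1` case is
`threePoint_prodBernoulli_of_graded` (`rcMeasureW_one`).
[cite: Grimmett2006, §1.4 eq. (1.20) (p. 15); §3.9 (pp. 63–65)] [cite: Linusson2011, Prop. 2.6] [cite: VandenbergGandolfi2012, §3 Def. 12]
[cite: Bjorner2011, Thm. 2.1]
-/

noncomputable section

namespace Summit.CriticalPhenomena.PercolationContinuityZ3.Theorems
namespace FK

open MeasureTheory Set Literature.Probability.LatticeModels Literature.Probability.Percolation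
open Literature.Probability.Percolation.BHK2006 (weight weight_nonneg)
open Literature.Probability.Percolation.DecisionTree (ind ind_of_mem ind_of_not_mem)
open scoped Classical symmDiff

variable {V : Type*} [Fintype V]

/-! ### Graded folding fibres for the random-cluster weights -/

/-- On the fibre `{a : a ∖ M = u}` the level-`L` part of `Σ_a q^{k(a)+k(a ∆ M)} 1[a ∈ A, a ∆ M ∈ B]` is `q^L · N_L(A;B)`:
`Σ_{a ∖ M = u} q^{k(a)+k(a∆M)} 1_A(a) 1_B(a ∆ M) = Σ_L q^L · fibreCountL M u A B L`. [cite: Bjorner2011, Thm. 2.1] [cite: Linusson2011, Prop. 2.6] -/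
theorem sum_fibre_pow_clusterCount_eq (q : ℝ) (M u : BondConfig V) (A B : Set (BondConfig V)) :
    ∑ a ∈ Finset.univ.filter (fun a : BondConfig V => a \ M = u),
        q ^ (clusterCount a ∅ + clusterCount (a ∆ M) ∅) * (ind A a * ind B (a ∆ M)) =
      ∑ L ∈ Finset.range (2 * Fintype.card V + 1), q ^ L * (fibreCountL M u A B L : ℝ) := by
  -- restrict to the configurations meeting `(A, B)` (the others contribute `0`)
  have h1 : ∑ a ∈ Finset.univ.filter (fun a : BondConfig V => a \ M = u),
        q ^ (clusterCount a ∅ + clusterCount (a ∆ M) ∅) * (ind A a * ind B (a ∆ M)) =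
      ∑ a ∈ Finset.univ.filter (fun a : BondConfig V => a \ M = u ∧ a ∈ A ∧ a ∆ M ∈ B),
        q ^ (clusterCount a ∅ + clusterCount (a ∆ M) ∅) := by
    rw [← Finset.sum_filter_add_sum_filter_not (Finset.univ.filter fun a : BondConfig V => a \ M = u)
      (fun a => a ∈ A ∧ a ∆ M ∈ B)]
    have hz : ∑ a ∈ (Finset.univ.filter fun a : BondConfig V => a \ M = u).filter (fun a => ¬ (a ∈ A ∧ a ∆ M ∈ B)),
        q ^ (clusterCount a ∅ + clusterCount (a ∆ M) ∅) * (ind A a * ind B (a ∆ M)) = 0 := by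
      refine Finset.sum_eq_zero fun a ha => ?_
      have hn : ¬ (a ∈ A ∧ a ∆ M ∈ B) := (Finset.mem_filter.1 ha).2
      by_cases hA : a ∈ A
      · have hB : a ∆ M ∉ B := fun hB => hn ⟨hA, hB⟩
        rw [ind_of_not_mem hB, mul_zero, mul_zero]
      · rw [ind_of_not_mem hA, zero_mul, mul_zero]
    rw [hz, add_zero, Finset.filter_filter]
    refine Finset.sum_congr rfl fun a ha => ?_
    have h := (Finset.mem_filter.1 ha).2
    rw [ind_of_mem h.2.1, ind_of_mem h.2.2, mul_one, mul_one]
  rw [h1]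
  -- group by the level `L = k(a) + k(a ∆ M)`
  rw [← Finset.sum_fiberwise_of_maps_to (s := Finset.univ.filter fun a : BondConfig V => a \ M = u ∧ a ∈ A ∧ a ∆ M ∈ B)
    (t := Finset.range (2 * Fintype.card V + 1)) (g := fun a : BondConfig V => clusterCount a ∅ + clusterCount (a ∆ M) ∅)
    (fun a _ => by
      have h1 := clusterCount_empty_le_card a
      have h2 := clusterCount_empty_le_card (a ∆ M)
      exact Finset.mem_coe.2 (Finset.mem_range.2 (by omega)))]
  refine Finset.sum_congr rfl fun L _ => ?_
  have hconst : ∀ a ∈ (Finset.univ.filter fun a : BondConfig V => a \ M = u ∧ a ∈ A ∧ a ∆ M ∈ B).filter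
      (fun a => clusterCount a ∅ + clusterCount (a ∆ M) ∅ = L),
      q ^ (clusterCount a ∅ + clusterCount (a ∆ M) ∅) = q ^ L := by
    intro a ha
    rw [(Finset.mem_filter.1 ha).2]
  rw [Finset.sum_congr rfl hconst, Finset.sum_const, nsmul_eq_mul, mul_comm]
  congr 1
  unfold fibreCountL
  rw [Finset.filter_filter]
  exact congrArg (fun s : Finset (BondConfig V) => (s.card : ℝ)) (Finset.filter_congr fun a _ => by simp only [and_assoc])

/-- **GRADED FOLDING IDENTITY for the random-cluster weights** `W_q = w(·) q^{k(·)}` (free boundary): for all events `A, B`,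
`(Σ_a W_q(a) 1_A(a)) (Σ_b W_q(b) 1_B(b)) = Σ_M Σ_u w(u) w(u ∆ M) · Σ_L q^L N_L(A;B)` — the disagreement set `M`, the common part `u`, and
within the fibre the level `L = k(a) + k(a ∆ M)`. [cite: VandenbergGandolfi2012, §3 Def. 12] [cite: Bjorner2011, Thm. 2.1]
[cite: Grimmett2006, §1.4 eq. (1.20) (p. 15)] -/
theorem sum_rcWeightW_ind_mul_sum_eq_sum_fibres (w : Sym2 V → unitInterval) (q : ℝ) (A B : Set (BondConfig V)) :
    (∑ a : BondConfig V, rcWeightW w q ∅ a * ind A a) * (∑ b : BondConfig V, rcWeightW w q ∅ b * ind B b) =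
      ∑ M : BondConfig V, ∑ u : BondConfig V, weight (fun e => (w e : ℝ)) u * weight (fun e => (w e : ℝ)) (u ∆ M) *
        ∑ L ∈ Finset.range (2 * Fintype.card V + 1), q ^ L * (fibreCountL M u A B L : ℝ) := by
  set wt : BondConfig V → ℝ := weight (fun e => (w e : ℝ)) with hwt
  rw [Finset.sum_mul_sum]
  -- reindex the second copy by the disagreement set `M = a ∆ b`
  have step1 : ∀ a : BondConfig V, ∑ b : BondConfig V, rcWeightW w q ∅ a * ind A a * (rcWeightW w q ∅ b * ind B b) =
      ∑ M : BondConfig V, rcWeightW w q ∅ a * ind A a * (rcWeightW w q ∅ (a ∆ M) * ind B (a ∆ M)) := by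
    intro a
    let e : Equiv.Perm (BondConfig V) :=
      Function.Involutive.toPerm (fun M : BondConfig V => a ∆ M) (symmDiff_right_involutive a)
    calc ∑ b : BondConfig V, rcWeightW w q ∅ a * ind A a * (rcWeightW w q ∅ b * ind B b)
        = ∑ M : BondConfig V, rcWeightW w q ∅ a * ind A a * (rcWeightW w q ∅ (e M) * ind B (e M)) :=
          (Equiv.sum_comp e (fun b => rcWeightW w q ∅ a * ind A a * (rcWeightW w q ∅ b * ind B b))).symm
      _ = _ := Finset.sum_congr rfl fun M _ => rfl
  simp_rw [step1]
  rw [Finset.sum_comm]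
  refine Finset.sum_congr rfl fun M _ => ?_
  -- group the first copy by its value `u = a \ M` off the disagreement set
  rw [← Finset.sum_fiberwise Finset.univ (fun a : BondConfig V => a \ M)
    (fun a => rcWeightW w q ∅ a * ind A a * (rcWeightW w q ∅ (a ∆ M) * ind B (a ∆ M)))]
  refine Finset.sum_congr rfl fun u _ => ?_
  have hfib : ∀ a ∈ (Finset.univ.filter fun a : BondConfig V => a \ M = u),
      rcWeightW w q ∅ a * ind A a * (rcWeightW w q ∅ (a ∆ M) * ind B (a ∆ M)) =
        wt u * wt (u ∆ M) * (q ^ (clusterCount a ∅ + clusterCount (a ∆ M) ∅) * (ind A a * ind B (a ∆ M))) := by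
    intro a ha
    have hau : a \ M = u := (Finset.mem_filter.1 ha).2
    unfold rcWeightW
    rw [← weight_mul_weight_symmDiff_eq (fun e => (w e : ℝ)) hau, pow_add]
    ring
  rw [Finset.sum_congr rfl hfib, ← Finset.mul_sum, sum_fibre_pow_clusterCount_eq]

/-- **`φ(A) φ(B) · Z² = Σ_M Σ_u w(u) w(u ∆ M) Σ_L q^L N_L(A;B)`** for `φ = rcMeasureW w q ∅`, `q > 0`.
[cite: Grimmett2006, §1.4 eq. (1.20) (p. 15)] [cite: VandenbergGandolfi2012, §3 Def. 12] -/
theorem rcMeasureW_real_mul_eq_sum_fibres_graded (w : Sym2 V → unitInterval) {q : ℝ} (hq : 0 < q) (A B : Set (BondConfig V)) :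
    (rcMeasureW w q ∅).real A * (rcMeasureW w q ∅).real B * (rcPartitionFunctionW w q ∅) ^ 2 =
      ∑ M : BondConfig V, ∑ u : BondConfig V, weight (fun e => (w e : ℝ)) u * weight (fun e => (w e : ℝ)) (u ∆ M) *
        ∑ L ∈ Finset.range (2 * Fintype.card V + 1), q ^ L * (fibreCountL M u A B L : ℝ) := by
  have hZ := rcPartitionFunctionW_pos w hq ∅
  rw [rcMeasureW_real_eq_sum_div w hq ∅ A, rcMeasureW_real_eq_sum_div w hq ∅ B, ← sum_rcWeightW_ind_mul_sum_eq_sum_fibres]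
  field_simp

/-- **Three graded fibre counts against one, level by level ⇒ three products against one for EVERY `φ_{w,q}`, `q > 0`.**
[cite: Linusson2011, Prop. 2.6] [cite: Grimmett2006, §3.9 (pp. 63–65)] -/
theorem rcMeasureW_three_mul_le_of_graded_fibrewise (w : Sym2 V → unitInterval) {q : ℝ} (hq : 0 < q)
    (A₁ B₁ A₂ B₂ A₃ B₃ A B : Set (BondConfig V))
    (h : ∀ M u : BondConfig V, Disjoint u M → ∀ L : ℕ,
      fibreCountL M u A₁ B₁ L + fibreCountL M u A₂ B₂ L + fibreCountL M u A₃ B₃ L ≤ fibreCountL M u A B L) :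
    (rcMeasureW w q ∅).real A₁ * (rcMeasureW w q ∅).real B₁ + (rcMeasureW w q ∅).real A₂ * (rcMeasureW w q ∅).real B₂ +
        (rcMeasureW w q ∅).real A₃ * (rcMeasureW w q ∅).real B₃ ≤
      (rcMeasureW w q ∅).real A * (rcMeasureW w q ∅).real B := by
  have hZ := rcPartitionFunctionW_pos w hq ∅
  rw [← mul_le_mul_iff_of_pos_right (pow_pos hZ 2), add_mul, add_mul,
    rcMeasureW_real_mul_eq_sum_fibres_graded w hq, rcMeasureW_real_mul_eq_sum_fibres_graded w hq,
    rcMeasureW_real_mul_eq_sum_fibres_graded w hq, rcMeasureW_real_mul_eq_sum_fibres_graded w hq, ← Finset.sum_add_distrib,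
    ← Finset.sum_add_distrib]
  refine Finset.sum_le_sum fun M _ => ?_
  rw [← Finset.sum_add_distrib, ← Finset.sum_add_distrib]
  refine Finset.sum_le_sum fun u _ => ?_
  have hw0 : ∀ e, 0 ≤ (fun e => (w e : ℝ)) e := fun e => (w e).2.1
  have hw1 : ∀ e, (fun e => (w e : ℝ)) e ≤ 1 := fun e => (w e).2.2
  have hW : 0 ≤ weight (fun e => (w e : ℝ)) u * weight (fun e => (w e : ℝ)) (u ∆ M) :=
    mul_nonneg (weight_nonneg hw0 hw1 _) (weight_nonneg hw0 hw1 _)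
  rw [← mul_add, ← mul_add]
  refine mul_le_mul_of_nonneg_left ?_ hW
  rw [← Finset.sum_add_distrib, ← Finset.sum_add_distrib]
  refine Finset.sum_le_sum fun L _ => ?_
  rw [← mul_add, ← mul_add]
  refine mul_le_mul_of_nonneg_left ?_ (pow_nonneg hq.le L)
  by_cases hd : Disjoint u M
  · exact_mod_cast h M u hd L
  · -- off the locus `u ∩ M = ∅` every graded fibre count vanishes
    have hempty : ∀ (C D : Set (BondConfig V)) (L : ℕ), fibreCountL M u C D L = 0 := by
      intro C D L
      unfold fibreCountL
      refine Finset.card_eq_zero.2 (Finset.filter_eq_empty_iff.2 fun a _ ha => hd ?_)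
      rw [← ha.1]
      exact disjoint_sdiff_self_left
    rw [hempty, hempty, hempty, hempty]
    simp

/-- **The graded three-point node ⇒ the three-point inequality for EVERY random-cluster measure `φ_{w,q}`, `q > 0`** (two independent
samples; free boundary): `φ(OV)φ(OY) + φ(OV)φ(VY) + φ(OY)φ(VY) ≤ φ(0)φ(OVY)`.  For `q = 1` this is `threePoint_prodBernoulli_of_graded`.
[cite: Grimmett2006, §1.4 eq. (1.20) (p. 15); §3.9 (pp. 63–65)] [cite: Linusson2011, Prop. 2.6] -/
theorem threePoint_rcMeasureW_of_graded (h : ThreePointGradedOn V) (w : Sym2 V → unitInterval) {q : ℝ} (hq : 0 < q) (o v y : V) :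
    (rcMeasureW w q ∅).real (pattOV o v y) * (rcMeasureW w q ∅).real (pattOY o v y) +
        (rcMeasureW w q ∅).real (pattOV o v y) * (rcMeasureW w q ∅).real (pattVY o v y) +
          (rcMeasureW w q ∅).real (pattOY o v y) * (rcMeasureW w q ∅).real (pattVY o v y) ≤
      (rcMeasureW w q ∅).real (patt0 o v y) * (rcMeasureW w q ∅).real (pattOVY o v y) :=
  rcMeasureW_three_mul_le_of_graded_fibrewise w hq _ _ _ _ _ _ _ _ fun M u hd L => h M u hd o v y L

/-- **`ThreePointGradedPos` ⇒ the three-point inequality for every `φ_{w,q}` on every `Fin n`, every `q > 0`.**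
[cite: Grimmett2006, §3.9 (pp. 63–65)] -/
theorem threePoint_rcMeasureW_of_gradedPos (h : ThreePointGradedPos) (n : ℕ) (w : Sym2 (Fin n) → unitInterval) {q : ℝ}
    (hq : 0 < q) (o v y : Fin n) :
    (rcMeasureW w q ∅).real (pattOV o v y) * (rcMeasureW w q ∅).real (pattOY o v y) +
        (rcMeasureW w q ∅).real (pattOV o v y) * (rcMeasureW w q ∅).real (pattVY o v y) +
          (rcMeasureW w q ∅).real (pattOY o v y) * (rcMeasureW w q ∅).real (pattVY o v y) ≤
      (rcMeasureW w q ∅).real (patt0 o v y) * (rcMeasureW w q ∅).real (pattOVY o v y) :=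
  threePoint_rcMeasureW_of_graded (h n) w hq o v y

end FK
end Summit.CriticalPhenomena.PercolationContinuityZ3.Theorems

end
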